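import Literature.Analysis.FluidPDE.InitialTimeCKNStep2
import Literature.Analysis.FluidPDE.InitialTimeCKNStep3
import Literature.Analysis.FluidPDE.CKNLocalRegularityRRSPressure
import HarnessLib

/-!
# A Caffarelli–Kohn–Nirenberg induction from the initial time: the induction assembled
(towards Barker–Prange 2020, Thm. 1 in the slab form used for Thm. 2)

Analysis/FluidPDE proofs file (theorems only, no definitions, no named facts) on the discharge
path of the named fact `Literature.Analysis.FluidPDE.BarkerPrange2020_thm2`
(`BarkerPrangeConcentration.lean`; T. Barker, C. Prange, Arch. Ration. Mech. Anal. 236 (2020) =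
arXiv:1812.09115, Thm. 2), assembling the initial-time induction of `InitialTimeCKNStep2.lean`
and `InitialTimeCKNStep3.lean` (see the module docstring of the latter for the road taken):

* `BarkerPrange2020.hypA'_one_of_hypA_one` — the base case `(A'_1)` from RRS's Step 1
  (`RRS2016.step1`, `(A_1)`: `C(1/2) + (1/2)^{1/2} D_osc(1/2) ≤ ε₀^{2/3}/8`, whence
  `C(1/2) + D_osc(1/2) ≤ 3 ε₀^{2/3}/8 ≤ ε₀^{2/3}`);
* `BarkerPrange2020.initialInduction` — **the induction** `(A'_1) ⇒ (B'_2) ⇒ (A'_2) ⇒ (B'_3) ⇒ …`: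
  there is an absolute `ε⋆ > 0` such that for every triple `(u, p, G)` on `Q_1(z₀)` with the
  properties of a suitable pair except that the local energy inequality carries the datum term
  `∫ |u₀|² φ(0, ·)` (weak gradient `G` square integrable, `p ∈ L^{3/2}`, `div u = 0`, the pressure
  equation, unit viscosity, no force), every `0 < ε₀ ≤ ε⋆` with
  `∫∫_{Q_1(z₀)} (|u|³ + |p|^{3/2}) ≤ ε₀`, and every `z = (s, a) ∈ Q_{1/2}(z₀)` at which the datum is
  Morrey-small (`∫_{B_ρ(a)} |u₀|² ≤ ε₀^{2/3} ρ`, `0 < ρ ≤ 1`): **`C(r_n) + D_osc(r_n) ≤ ε₀^{2/3}` at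
  `z` for every `n ≥ 1`** (`r_n = 2⁻ⁿ`): the smallness of the scale-invariant quantities
  propagates from the unit scale to all dyadic scales.

The steps are the proved `initialStep2_holds` (with `C_B`), `initialStep3_of_lemma15_12`
(with `ε₁(C_B)`, fed with the proved `RRS2016.lemma15_12_holds`) and `RRS2016.step1`;
`ε⋆ = min(ε₁(C_B), 2^{-21})`.

## References

* T. Barker, C. Prange, Arch. Ration. Mech. Anal. 236 (2020) = arXiv:1812.09115, Thm. 1, §4.
  [BarkerPrange2020]
* J. C. Robinson, J. L. Rodrigo, W. Sadowski, *The three-dimensional Navier–Stokes equations*,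
  CUP (2016), proof of Thm. 15.3, Steps 1–3 (pp. 220–225). [RobinsonRodrigoSadowski2016]
* L. Caffarelli, R. Kohn, L. Nirenberg, Comm. Pure Appl. Math. 35 (1982), Proposition 1.
-/

noncomputable section

open MeasureTheory Set Function Filter Topology TopologicalSpace Metric
open scoped NNReal ENNReal InnerProductSpace RealInnerProductSpace Laplacian

namespace Literature.Analysis.FluidPDE

namespace BarkerPrange2020

open RRS2016

/-- **The base case `(A'_1)` from `(A_1)`**: `C(1/2) + (1/2)^{1/2} D_osc(1/2) ≤ ε₀^{2/3} (1/2)³`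
implies `C(1/2) + D_osc(1/2) ≤ ε₀^{2/3}` (since `(1/2)^{1/2} ≥ 1/2`, `D_osc ≤ ε₀^{2/3}/4`). [folklore] -/
theorem hypA'_one_of_hypA_one {ε₀ : ℝ} (hε : 0 ≤ ε₀) {z : ℝ × EuclideanSpace ℝ (Fin 3)}
    {u : ℝ → EuclideanSpace ℝ (Fin 3) → EuclideanSpace ℝ (Fin 3)}
    {p : ℝ → EuclideanSpace ℝ (Fin 3) → ℝ} (h : HypA ε₀ u p 1 z) :
    cknC (rad 1) z u + cknDOsc (rad 1) z p ≤ ENNReal.ofReal (ε₀ ^ (2 / 3 : ℝ)) := by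
  unfold HypA at h
  set B : ℝ≥0∞ := ENNReal.ofReal (ε₀ ^ (2 / 3 : ℝ) * rad 1 ^ 3) with hB
  have hε23 : 0 ≤ ε₀ ^ (2 / 3 : ℝ) := Real.rpow_nonneg hε _
  have hC : cknC (rad 1) z u ≤ B := le_self_add.trans h
  have hs : (1 / 2 : ℝ) ≤ (rad 1) ^ (1 / 2 : ℝ) := by
    rw [rad_one]
    have : (1 / 2 : ℝ) ^ (1 : ℝ) ≤ (1 / 2 : ℝ) ^ (1 / 2 : ℝ) :=
      Real.rpow_le_rpow_of_exponent_ge (by norm_num) (by norm_num) (by norm_num)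
    simpa using this
  have hs0 : ENNReal.ofReal ((rad 1) ^ (1 / 2 : ℝ)) ≠ 0 :=
    (ENNReal.ofReal_pos.2 (Real.rpow_pos_of_pos (rad_pos 1) _)).ne'
  have hD' : cknDOsc (rad 1) z p ≤ B / ENNReal.ofReal ((rad 1) ^ (1 / 2 : ℝ)) := by
    rw [ENNReal.le_div_iff_mul_le (Or.inl hs0) (Or.inl ENNReal.ofReal_ne_top), mul_comm]
    exact le_add_self.trans h
  have hD : cknDOsc (rad 1) z p ≤ ENNReal.ofReal (ε₀ ^ (2 / 3 : ℝ) / 4) := by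
    refine hD'.trans ?_
    rw [hB, ← ENNReal.ofReal_div_of_pos (Real.rpow_pos_of_pos (rad_pos 1) _)]
    refine ENNReal.ofReal_le_ofReal ?_
    rw [div_le_iff₀ (Real.rpow_pos_of_pos (rad_pos 1) _), rad_one]
    calc ε₀ ^ (2 / 3 : ℝ) * (1 / 2 : ℝ) ^ 3 = ε₀ ^ (2 / 3 : ℝ) / 4 * (1 / 2) := by ring
      _ ≤ ε₀ ^ (2 / 3 : ℝ) / 4 * ((1 / 2 : ℝ) ^ (1 / 2 : ℝ)) := by
          rw [← rad_one]; rw [rad_one] at hs ⊢; gcongr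
  calc cknC (rad 1) z u + cknDOsc (rad 1) z p ≤ B + ENNReal.ofReal (ε₀ ^ (2 / 3 : ℝ) / 4) :=
        add_le_add hC hD
    _ = ENNReal.ofReal (ε₀ ^ (2 / 3 : ℝ) * rad 1 ^ 3 + ε₀ ^ (2 / 3 : ℝ) / 4) := by
        rw [hB, ← ENNReal.ofReal_add (by have := rad_pos 1; positivity) (by positivity)]
    _ ≤ ENNReal.ofReal (ε₀ ^ (2 / 3 : ℝ)) := by
        refine ENNReal.ofReal_le_ofReal ?_
        rw [rad_one]
        nlinarith

/-- **The initial-time induction** (RRS pp. 220–225, Steps 1–3, in the scale-invariant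
normalisation with the datum term): there is an absolute `ε⋆ > 0` such that, for every triple
`(u, p, G)` on `Q_1(z₀)` with `G` the weak spatial gradient of `u`, `∫∫_{Q_1(z₀)} |G|² < ∞`, `p`
locally integrable with `∫∫_{Q_1(z₀)} |p|^{3/2} < ∞`, `div u = 0` and the pressure equation
`-Δp = ∂ᵢ∂ⱼ(uᵢuⱼ)` in `𝒟'(Q_1(z₀))`, and the local energy inequality with the datum term
`∫ |u₀|² φ(0, ·)` for nonnegative tests on `Q_1(z₀)` (unit viscosity, no force); for every
`0 < ε₀ ≤ ε⋆` with `∫∫_{Q_1(z₀)} (|u|³ + |p|^{3/2}) ≤ ε₀`; for every `z = (s, a) ∈ Q_{1/2}(z₀)` with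
`∫_{B_ρ(a)} |u₀|² ≤ ε₀^{2/3} ρ` for `0 < ρ ≤ 1`; and for every `n ≥ 1`:
`C(r_n) + D_osc(r_n) ≤ ε₀^{2/3}` at `z` (`cknC`, `cknDOsc`, `r_n = 2⁻ⁿ`). The chain is
`(A'_1)` (`RRS2016.step1` and `hypA'_one_of_hypA_one`) `⇒ (B'_2)` (`initialStep2_holds`)
`⇒ (A'_2)` (`initialStep3_of_lemma15_12` with `RRS2016.lemma15_12_holds`) `⇒ (B'_3) ⇒ …`;
`ε⋆ = min(ε₁(C_B), 2^{-21})`. [cite: RobinsonRodrigoSadowski2016, proof of Thm. 15.3, Steps 1–3, pp. 220–225; BarkerPrange2020, Thm. 1] -/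
theorem initialInduction :
    ∃ εs : ℝ, 0 < εs ∧
      ∀ (z₀ : ℝ × EuclideanSpace ℝ (Fin 3))
        (u₀ : EuclideanSpace ℝ (Fin 3) → EuclideanSpace ℝ (Fin 3))
        (u : ℝ → EuclideanSpace ℝ (Fin 3) → EuclideanSpace ℝ (Fin 3))
        (p : ℝ → EuclideanSpace ℝ (Fin 3) → ℝ)
        (G : ℝ → EuclideanSpace ℝ (Fin 3) → EuclideanSpace ℝ (Fin 3) →L[ℝ] EuclideanSpace ℝ (Fin 3)),
        HasWeakSpatialGradientOn (parabolicCylinderOpens 1 z₀) u G →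
        ∫⁻ w in parabolicCylinder 1 z₀, ENNReal.ofReal (frobeniusNormSq (G w.1 w.2)) < ∞ →
        LocallyIntegrableOn (uncurry p) (parabolicCylinder 1 z₀) volume →
        ∫⁻ w in parabolicCylinder 1 z₀, ‖p w.1 w.2‖ₑ ^ (3 / 2 : ℝ) < ∞ →
        (∀ θ : ℝ → EuclideanSpace ℝ (Fin 3) → ℝ, IsSpaceTimeTestOn (parabolicCylinderOpens 1 z₀) θ →
          ∫ w in parabolicCylinder 1 z₀, ⟪u w.1 w.2, gradient (θ w.1) w.2⟫ = 0) →
        (∀ φ : ℝ → EuclideanSpace ℝ (Fin 3) → ℝ, IsSpaceTimeTestOn (parabolicCylinderOpens 1 z₀) φ →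
          ∫ w in parabolicCylinder 1 z₀,
            (⟪u w.1 w.2, convect (u w.1) (gradient (φ w.1)) w.2⟫ + p w.1 w.2 * Δ (φ w.1) w.2) = 0) →
        (∀ φ : ℝ → EuclideanSpace ℝ (Fin 3) → ℝ, IsSpaceTimeTestOn (parabolicCylinderOpens 1 z₀) φ →
          (∀ t x, 0 ≤ φ t x) →
          2 * 1 * ∫ t, ∫ x, frobeniusNormSq (G t x) * φ t x ≤
            (∫ x, ‖u₀ x‖ ^ 2 * φ 0 x) +
            ∫ t, ∫ x, (‖u t x‖ ^ 2 * (timeDeriv φ t x + 1 * Δ (φ t) x) +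
              (‖u t x‖ ^ 2 + 2 * p t x) * ⟪u t x, gradient (φ t) x⟫)) →
        ∀ ε₀ : ℝ, 0 < ε₀ → ε₀ ≤ εs → Small ε₀ u p z₀ →
          ∀ z ∈ parabolicCylinder (1 / 2) z₀,
            (∀ ρ : ℝ, 0 < ρ → ρ ≤ 1 →
              ∫⁻ x in ball z.2 ρ, ‖u₀ x‖ₑ ^ 2 ≤ ENNReal.ofReal (ε₀ ^ (2 / 3 : ℝ) * ρ)) →
            ∀ n : ℕ, 1 ≤ n →
              cknC (rad n) z u + cknDOsc (rad n) z p ≤ ENNReal.ofReal (ε₀ ^ (2 / 3 : ℝ)) := by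
  obtain ⟨CB, hCB, H2⟩ := initialStep2_holds
  obtain ⟨ε₁, hε₁, H3⟩ := initialStep3_of_lemma15_12 lemma15_12_holds CB hCB
  refine ⟨min ε₁ (2⁻¹ ^ 21), lt_min hε₁ (by positivity), ?_⟩
  intro z₀ u₀ u p G hG hG2 hp hp32 hdiv hPeq hLEI ε₀ hε₀ hε₀le hsmall z hz hN n hn
  have hε₀₁ : ε₀ ≤ ε₁ := hε₀le.trans (min_le_left _ _)
  have hε₀₂ : ε₀ ≤ 2⁻¹ ^ 21 := hε₀le.trans (min_le_right _ _)
  have hpm : AEStronglyMeasurable (uncurry p) (volume.restrict (parabolicCylinder 1 z₀)) :=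
    hp.aestronglyMeasurable
  -- the induction `(A'_1) ⇒ (B'_2) ⇒ (A'_2) ⇒ (B'_3) ⇒ …`
  have hind : ∀ m : ℕ, 1 ≤ m →
      (∀ k, 1 ≤ k → k ≤ m → cknC (rad k) z u + cknDOsc (rad k) z p ≤ ENNReal.ofReal (ε₀ ^ (2 / 3 : ℝ))) ∧
      (∀ k, 2 ≤ k → k ≤ m →
        cknAEss (rad k) z u + cknE (rad k) z G ≤ ENNReal.ofReal (CB * ε₀ ^ (2 / 3 : ℝ))) := by
    intro m hm
    induction m, hm using Nat.le_induction with
    | base =>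
        refine ⟨fun k hk1 hk2 => ?_, fun k hk1 hk2 => by omega⟩
        obtain rfl : k = 1 := le_antisymm hk2 hk1
        exact hypA'_one_of_hypA_one hε₀.le (step1 hz hpm hε₀.le hε₀₂ hsmall)
    | succ m hm ih =>
        obtain ⟨ihA, ihB⟩ := ih
        have hBnew : cknAEss (rad (m + 1)) z u + cknE (rad (m + 1)) z G ≤
            ENNReal.ofReal (CB * ε₀ ^ (2 / 3 : ℝ)) :=
          H2 z₀ u₀ u p G hG hG2 hp hp32 hdiv hLEI ε₀ hε₀ hsmall z hz hN m hm ihA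
        have hB' : ∀ k, 2 ≤ k → k ≤ m + 1 →
            cknAEss (rad k) z u + cknE (rad k) z G ≤ ENNReal.ofReal (CB * ε₀ ^ (2 / 3 : ℝ)) := by
          intro k hk1 hk2
          rcases Nat.lt_or_ge k (m + 1) with hlt | hge
          · exact ihB k hk1 (by omega)
          · obtain rfl : k = m + 1 := le_antisymm hk2 hge
            exact hBnew
        have hAnew : cknC (rad (m + 1)) z u + cknDOsc (rad (m + 1)) z p ≤ ENNReal.ofReal (ε₀ ^ (2 / 3 : ℝ)) :=
          H3 z₀ u p G hG hp hPeq ε₀ hε₀ hε₀₁ hsmall z hz (m + 1) (by omega) hB'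
        refine ⟨fun k hk1 hk2 => ?_, hB'⟩
        rcases Nat.lt_or_ge k (m + 1) with hlt | hge
        · exact ihA k hk1 (by omega)
        · obtain rfl : k = m + 1 := le_antisymm hk2 hge
          exact hAnew
  exact (hind n hn).1 n hn le_rfl

end BarkerPrange2020

end Literature.Analysis.FluidPDE

end
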